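import Summits.CriticalPhenomena.Ising3DConformalLimit.Theorems.PlantedPinningMoebiusLimitExistsHessianKernels
import Summits.CriticalPhenomena.Ising3DConformalLimit.Theorems.PlantedPinningMoebiusLimitExistsRegularPolygonReflection
import HarnessLib

/-!
# Full dihedral invariance of the Ising₃ Ward-defect jet at the regular polygon
(crux `MoebiusLimitExists`, stmt-CriticalPhenomena-1344, line `Sketch` v26/v27, lead prover-line-stmt-CriticalPhenomena-1344-c20-0;
THEOREM-ONLY, `--supports stmt-CriticalPhenomena-1344`)

`…HessianKernels.lean` (p167786) proved the invariance of every Taylor coefficient of the `K_{e₀}` defect `D_n` at the unit regular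
horizontal `n`-gon `P_n` under the ROTATION by `2π/n` (with cyclic relabelling).  With the in-plane REFLECTION of `P_n` (N1c
`stub_regularPolygon_reflection` p168081: a linear isometry `Z` fixing `e₀` with `Z P_nᵢ = P_n(n−1−i)`) the same transport lemma
(`jetK1_comp_symmetry`) gives the invariance under the reflection with relabelling `Fin.rev`, hence under the full dihedral stabiliser
`D_n` of `P_n` in `O(3)_{e₀} ⋉ S_n`.  Exact linear algebra on top of the landed structure (parity, the five order-2 kernels, `D_n`):
at `(n, k) = (4, 2)` exactly `2` of the `78` Hessian entries of `D_4` at the square are unconstrained, at `(6, 2)` `4` of `171`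
(evidence `hessian_count.md` on the crux item) — the first conformal data of the Ising₃ `2k`-point functions in this language.
References: Di Francesco–Mathieu–Sénéchal 1997 §4.1 (4.18)–(4.19) [FrancescoMathieuSenechal1997].  No definitions, no `sorry`.
-/

noncomputable section

namespace Summit.CriticalPhenomena.Ising3DConformalLimit.MoebiusLimitExistsDihedralJet

open Literature.Probability.LatticeModels
open Summit.CriticalPhenomena.Ising3DConformalLimit.MoebiusLimitExistsSketchV26 (stub_regularPolygon_reflection)
open Summit.CriticalPhenomena.Ising3DConformalLimit.MoebiusLimitExistsHessianKernels (jetK1_comp_symmetry)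

section Limit

variable {ρ : ℝ → ℝ} {Δ : ℝ} {S : CorrFamily 3}

open Summit.CriticalPhenomena.Ising3DConformalLimit.Cruxes.InversionUpgradeNormalised.FreeEndpointGaussianClosure
  (isPermutationSymmetric_of_limit)

/-- **Reflection invariance of the jet at the regular polygon** (N1c + `jetK1_comp_symmetry` with `σ = Fin.revPerm`): together with the
rotation (`…HessianKernels.lean`) the full dihedral invariance of every Taylor coefficient of `D_n` at `P_n`. [cite: FrancescoMathieuSenechal1997, §4.1 (4.18)–(4.19)] -/
theorem limit_jetK1_reflection_invariant_at_regularPolygon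
    (hlim : HasPointwiseScalingLimit (criticalCorr 3) ρ S)
    (hnorm : ∀ n z, z ∉ NonCoincident 3 n → S n z = 0) (heuc : IsEuclideanInvariant S) (n : ℕ) :
    ∃ Z : EuclideanSpace ℝ (Fin 3) ≃ₗᵢ[ℝ] EuclideanSpace ℝ (Fin 3),
      Z (EuclideanSpace.single 0 1) = EuclideanSpace.single 0 1 ∧
      (∀ i : Fin n,
        Z (Real.cos (2 * Real.pi * ((i : ℕ) : ℝ) / (n : ℝ)) • (EuclideanSpace.single 1 1 : EuclideanSpace ℝ (Fin 3)) +
            Real.sin (2 * Real.pi * ((i : ℕ) : ℝ) / (n : ℝ)) • (EuclideanSpace.single 2 1 : EuclideanSpace ℝ (Fin 3))) =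
          Real.cos (2 * Real.pi * (((Fin.rev i : Fin n) : ℕ) : ℝ) / (n : ℝ)) •
              (EuclideanSpace.single 1 1 : EuclideanSpace ℝ (Fin 3)) +
            Real.sin (2 * Real.pi * (((Fin.rev i : Fin n) : ℕ) : ℝ) / (n : ℝ)) •
              (EuclideanSpace.single 2 1 : EuclideanSpace ℝ (Fin 3))) ∧
      ∀ (k : ℕ) (m : Fin k → Fin n → EuclideanSpace ℝ (Fin 3)),
        iteratedFDeriv ℝ k (fun x : Fin n → EuclideanSpace ℝ (Fin 3) =>
            fderiv ℝ (S n) x (fun i => ‖x i‖ ^ 2 • (EuclideanSpace.single 0 1 : EuclideanSpace ℝ (Fin 3)) -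
              (2 * inner ℝ (EuclideanSpace.single 0 1 : EuclideanSpace ℝ (Fin 3)) (x i)) • x i) -
            2 * Δ * (∑ i, inner ℝ (EuclideanSpace.single 0 1 : EuclideanSpace ℝ (Fin 3)) (x i)) * S n x)
          (fun i : Fin n => Real.cos (2 * Real.pi * ((i : ℕ) : ℝ) / (n : ℝ)) • (EuclideanSpace.single 1 1 : EuclideanSpace ℝ (Fin 3)) +
            Real.sin (2 * Real.pi * ((i : ℕ) : ℝ) / (n : ℝ)) • (EuclideanSpace.single 2 1 : EuclideanSpace ℝ (Fin 3)))
          (fun j i => Z (m j (Fin.revPerm.symm i))) =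
        iteratedFDeriv ℝ k (fun x : Fin n → EuclideanSpace ℝ (Fin 3) =>
            fderiv ℝ (S n) x (fun i => ‖x i‖ ^ 2 • (EuclideanSpace.single 0 1 : EuclideanSpace ℝ (Fin 3)) -
              (2 * inner ℝ (EuclideanSpace.single 0 1 : EuclideanSpace ℝ (Fin 3)) (x i)) • x i) -
            2 * Δ * (∑ i, inner ℝ (EuclideanSpace.single 0 1 : EuclideanSpace ℝ (Fin 3)) (x i)) * S n x)
          (fun i : Fin n => Real.cos (2 * Real.pi * ((i : ℕ) : ℝ) / (n : ℝ)) • (EuclideanSpace.single 1 1 : EuclideanSpace ℝ (Fin 3)) +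
            Real.sin (2 * Real.pi * ((i : ℕ) : ℝ) / (n : ℝ)) • (EuclideanSpace.single 2 1 : EuclideanSpace ℝ (Fin 3))) m := by
  obtain ⟨Z, hZ0, hZP⟩ := stub_regularPolygon_reflection n
  refine ⟨Z, hZ0, hZP, fun k m => ?_⟩
  have hperm := isPermutationSymmetric_of_limit hlim hnorm
  exact jetK1_comp_symmetry n (S n) Δ (fun R' y => heuc.2 n R' y) (fun σ y => hperm n σ y) Z hZ0
    Fin.revPerm _ (fun i => hZP i) k m

end Limit

/-! ## Registered anchor -/

/-- **Registered anchor of this file — reflection invariance of the `K_{e₀}` Ward-defect jet of the Ising₃ `n`-point limit at the unit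
regular horizontal `n`-gon** (explicit-binder form of `limit_jetK1_reflection_invariant_at_regularPolygon`). [cite: FrancescoMathieuSenechal1997, §4.1 (4.18)–(4.19)] -/
theorem limit_sctDefectK1_jet_reflection_invariant_at_regularPolygon : ∀ (ρ : ℝ → ℝ) (Δ : ℝ) (S : Literature.Probability.LatticeModels.CorrFamily 3), Literature.Probability.LatticeModels.HasPointwiseScalingLimit (Literature.Probability.LatticeModels.criticalCorr 3) ρ S → (∀ n z, z ∉ Literature.Probability.LatticeModels.NonCoincident 3 n → S n z = 0) → Literature.Probability.LatticeModels.IsEuclideanInvariant S → ∀ n : ℕ, ∃ Z : EuclideanSpace ℝ (Fin 3) ≃ₗᵢ[ℝ] EuclideanSpace ℝ (Fin 3), Z (EuclideanSpace.single 0 1) = EuclideanSpace.single 0 1 ∧ (∀ i : Fin n, Z ((fun i : Fin n => Real.cos (2 * Real.pi * ((i : ℕ) : ℝ) / (n : ℝ)) • (EuclideanSpace.single 1 1 : EuclideanSpace ℝ (Fin 3)) + Real.sin (2 * Real.pi * ((i : ℕ) : ℝ) / (n : ℝ)) • (EuclideanSpace.single 2 1 : EuclideanSpace ℝ (Fin 3)))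 i) = (fun i : Fin n => Real.cos (2 * Real.pi * ((i : ℕ) : ℝ) / (n : ℝ)) • (EuclideanSpace.single 1 1 : EuclideanSpace ℝ (Fin 3)) + Real.sin (2 * Real.pi * ((i : ℕ) : ℝ) / (n : ℝ)) • (EuclideanSpace.single 2 1 : EuclideanSpace ℝ (Fin 3))) (Fin.rev i)) ∧ ∀ (k : ℕ) (m : Fin k → Fin n → EuclideanSpace ℝ (Fin 3)), iteratedFDeriv ℝ k (fun x : Fin n → EuclideanSpace ℝ (Fin 3) => fderiv ℝ (S n) x (fun i => ‖x i‖ ^ 2 • (EuclideanSpace.single 0 1 : EuclideanSpace ℝ (Fin 3)) - (2 * inner ℝ (EuclideanSpace.single 0 1 : EuclideanSpace ℝ (Fin 3)) (x i)) • x i) - 2 * Δ * (∑ i, inner ℝ (EuclideanSpace.single 0 1 : EuclideanSpace ℝ (Fin 3)) (x i)) * S n x) (fun i : Fin n => Real.cos (2 * Real.pi * ((i : ℕ) : ℝ) / (n : ℝ)) • (EuclideanSpace.single 1 1 : EuclideanSpace ℝ (Fin 3)) + Real.sin (2 * Real.pi * ((i : ℕ) : ℝ) / (n : ℝ)) • (EuclideanSpace.single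 2 1 : EuclideanSpace ℝ (Fin 3))) (fun j i => Z (m j (Fin.revPerm.symm i))) = iteratedFDeriv ℝ k (fun x : Fin n → EuclideanSpace ℝ (Fin 3) => fderiv ℝ (S n) x (fun i => ‖x i‖ ^ 2 • (EuclideanSpace.single 0 1 : EuclideanSpace ℝ (Fin 3)) - (2 * inner ℝ (EuclideanSpace.single 0 1 : EuclideanSpace ℝ (Fin 3)) (x i)) • x i) - 2 * Δ * (∑ i, inner ℝ (EuclideanSpace.single 0 1 : EuclideanSpace ℝ (Fin 3)) (x i)) * S n x) (fun i : Fin n => Real.cos (2 * Real.pi * ((i : ℕ) : ℝ) / (n : ℝ)) • (EuclideanSpace.single 1 1 : EuclideanSpace ℝ (Fin 3)) + Real.sin (2 * Real.pi * ((i : ℕ) : ℝ) / (n : ℝ)) • (EuclideanSpace.single 2 1 : EuclideanSpace ℝ (Fin 3))) m :=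
  fun _ _ _ hlim hnorm heuc n => limit_jetK1_reflection_invariant_at_regularPolygon hlim hnorm heuc n

end Summit.CriticalPhenomena.Ising3DConformalLimit.MoebiusLimitExistsDihedralJet

end
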